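import Literature.MathematicalPhysics.QuantumFieldTheory.AoyamaEtAl2006.QTypeSubdiagrams
import HarnessLib

/-!
# AHKN's printed «if and only if» for one-particle irreducibility of q-type (sub)diagrams — graph-theoretic 1PI ⟺ the steps-over criterion — PROVED; and the typed UV-subdiagram family `uvSubdiagrams` evaluated (kernel `decide`) on the cell's STEP-0 ladder and CORE-8 panel words

HONEST FRAMING (venture `QEDPrecision`, cell `qed-hepp`, seat `qed-hepp-lit` gen 2; VALUE-FREE: finite combinatorics of line sets of words — no
amplitude, no integral, no number of any Set-V family; tenth-order words appear only through their published pairing words / subdiagram STRUCTURE,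
which is not a blinded quantity). Companion of `AoyamaEtAl2006/QTypeSubdiagrams.lean` (the q-type model: `Line`, `ends`, `segment`, `lines`,
`externalLines`, `floating`, `OnePI`, `IsUVSubdiagram`, `uvSubdiagrams`, and `subgraphSystem_uvSubdiagrams` ⇒ Rivasseau's (II.3.19) for every
q-type word). That file DEFINES 1PI by the printed steps-over criterion and listed the equivalence with the graph-theoretic notion as NOT CLAIMED;
this file closes it, so that a UV-subdiagram table produced with EITHER test (the cell's generator gen-02 tests bridgelessness of the sub-word's
graph; AHKN's text gives the steps-over rule) is the typed family.

SOURCE, AS PRINTED. [AoyamaEtAl2006] T. Aoyama, M. Hayakawa, T. Kinoshita, M. Nio, Nucl. Phys. B 740 (2006) 138 = arXiv:hep-ph/0512288 (`lit read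
paper:arxiv-hep-ph_0512288`, e-print numbering). §5.4 (chunk p0018:L9–L20): «The diagram corresponding to a pairing generated above may not satisfy
the 1PI condition. Since a q-type diagram is connected by lepton lines, it is sufficient to check whether it stays connected when one of the lepton
lines is eliminated. A q-type diagram is 1PI if and only if for each lepton line l_k, there exists at least one photon line that steps over the
lepton line, i.e., two end points of photon line, (v_i, v_j), satisfy v_i ≤ v_{k−1} and v_j ≥ v_k simultaneously.» §6.1 (p0019:L47–L60): «It is
one-particle irreducible, i.e., it stays connected when any one of the lepton lines that belong to the subdiagram is eliminated. The second
condition is satisfied when for every lepton line, l_{i+1}, …, l_j, there is at least one photon line that belongs to the subdiagram (both endpoints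
of it lie between v_i and v_j) which steps over the lepton line.»

TYPING. `lineGraph w s` = the adjacency of the multigraph spanned by a line set `s` (distinct vertices sharing a line of `s`; a Mathlib `SimpleGraph`
on the vertices `Fin (m+1)` — parallel lines give one adjacency, which is all connectivity sees); `SegmentConnected w s i j` = every two vertices of
`[v_i, v_j]` are `Reachable` through `s`; `IsOnePIGraph w i j` = the printed words: `segment w i j` is connected and stays connected «when any one
of the lepton lines that belong to the subdiagram is eliminated». PROVED: `isOnePIGraph_of_onePI` (the photon stepping over the eliminated lepton
line rejoins the two halves, each connected by its remaining lepton lines), `onePI_of_isOnePIGraph` (if no photon of the subdiagram steps over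
`(v_k, v_{k+1})`, every surviving line respects the cut `{≤ v_k} | {≥ v_{k+1}}`, so `v_i` and `v_j` are disconnected — a walk induction),
`isOnePIGraph_iff_onePI` (the printed «if and only if», for every segment with `i < j`; the whole diagram is the segment `[v_0, v_m]`),
`segmentConnected_erase_inr` («it is sufficient to check … lepton lines»: eliminating a photon never disconnects). SANITY / CROSS-CHECK (kernel
`decide`): `uvSubdiagrams w` listed explicitly for `abccba`, `abcddcba`, `abaccddb` and the eight tenth-order panel words of the cell (`abaccdedbe`,
`abcdcadeeb`, `abcdeecadb`, `abacdcedeb`, `abcdedeacb`, `abcbdceeda`, `abcabddeec`, `abcdedecba` = its X086, X312, X388, X104, X382, X228, X164, X062) —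
each equal, as a family of line sets, to the cell's generator table (specs `S…`/`V…` = self-energy/vertex + lepton line numbers + photon letters;
lepton `l_k` ↦ `Sum.inl (k−1)`, letters `a, b, …` ↦ `Sum.inr 0, 1, …`). NOT CLAIMED: anything about amplitudes or forests beyond the companion file.
-/

namespace Literature.MathematicalPhysics.QuantumFieldTheory.AoyamaEtAl2006

open Finset

variable {m : ℕ} {P : Type*} [DecidableEq P] [Fintype P]

section OnePIGraph

variable (w : Fin (m + 1) → P)

/-- The (multi)graph spanned by a line set, as a simple adjacency: two distinct vertices joined by a line of `s`. [cite: AoyamaEtAl2006, §5.1] -/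
def lineGraph (s : Finset (Line m P)) : SimpleGraph (Fin (m + 1)) where
  Adj u v := u ≠ v ∧ ∃ l ∈ s, u ∈ ends w l ∧ v ∈ ends w l
  symm := ⟨fun _ _ h => ⟨h.1.symm, h.2.imp fun _ hl => ⟨hl.1, hl.2.2, hl.2.1⟩⟩⟩
  loopless := ⟨fun _ h => h.1 rfl⟩

/-- Adjacency in `lineGraph` is decidable. [folklore] -/
instance instDecidableRelLineGraphAdj (s : Finset (Line m P)) : DecidableRel (lineGraph w s).Adj :=
  fun u v => inferInstanceAs (Decidable (u ≠ v ∧ ∃ l ∈ s, u ∈ ends w l ∧ v ∈ ends w l))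

/-- «connected»: all vertices `v_i, …, v_j` of the segment are joined to each other through lines of `s`. [cite: AoyamaEtAl2006, §6.1] -/
def SegmentConnected (s : Finset (Line m P)) (i j : Fin (m + 1)) : Prop :=
  ∀ u v : Fin (m + 1), (i : ℕ) ≤ u → (u : ℕ) ≤ j → (i : ℕ) ≤ v → (v : ℕ) ≤ j → (lineGraph w s).Reachable u v

/-- One-particle irreducibility of the subdiagram `[v_i, v_j]` AS PRINTED IN WORDS: it is connected and «it stays connected when any one of the lepton lines
that belong to the subdiagram is eliminated». [cite: AoyamaEtAl2006, §6.1] -/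
def IsOnePIGraph (i j : Fin (m + 1)) : Prop :=
  SegmentConnected w (segment w i j) i j ∧
    ∀ k : Fin m, (Sum.inl k : Line m P) ∈ segment w i j → SegmentConnected w ((segment w i j).erase (Sum.inl k)) i j

variable {w} {i j : Fin (m + 1)}

/-- Membership in a cut is constant along walks whose every edge respects the cut. [folklore] -/
private theorem iff_of_reachable {G : SimpleGraph (Fin (m + 1))} {p : Fin (m + 1) → Prop} (h : ∀ a b, G.Adj a b → (p a ↔ p b))
    {u v : Fin (m + 1)} (huv : G.Reachable u v) : p u ↔ p v := by
  obtain ⟨q⟩ := huv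
  induction q with
  | nil => exact Iff.rfl
  | cons hadj _ ih => exact (h _ _ hadj).trans ih

omit [Fintype P] in
/-- A lepton line in `s` joins consecutive vertices in `lineGraph w s`. [cite: AoyamaEtAl2006, §5.1] -/
theorem lineGraph_adj_of_inl_mem {s : Finset (Line m P)} {k : Fin m} (hk : (Sum.inl k : Line m P) ∈ s) :
    (lineGraph w s).Adj k.castSucc k.succ :=
  ⟨fun h => by have := congrArg Fin.val h; simp only [Fin.val_castSucc, Fin.val_succ] at this; omega,
    Sum.inl k, hk, mem_ends_inl.2 (Or.inl (Fin.val_castSucc k)), mem_ends_inl.2 (Or.inr (Fin.val_succ k))⟩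

omit [Fintype P] in
/-- If every pair of consecutive vertices of `[v_a, v_b]` is adjacent, all its vertices are mutually reachable («Since a q-type diagram is connected by
lepton lines …»). [cite: AoyamaEtAl2006, §5.4] -/
theorem segmentConnected_of_consecutive {s : Finset (Line m P)} {a b : Fin (m + 1)}
    (h : ∀ k : Fin m, (a : ℕ) ≤ k → (k : ℕ) + 1 ≤ b → (lineGraph w s).Adj k.castSucc k.succ) : SegmentConnected w s a b := by
  -- every vertex of the segment is reachable from `v_a`
  have key : ∀ d : ℕ, ∀ v : Fin (m + 1), (v : ℕ) = a + d → (v : ℕ) ≤ b → (lineGraph w s).Reachable a v := by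
    intro d
    induction d with
    | zero =>
      intro v hv _
      rw [show v = a from Fin.ext (by omega)]
    | succ d ih =>
      intro v hv hvb
      obtain ⟨k, hk⟩ : ∃ k : Fin m, (k : ℕ) = a + d := ⟨⟨a + d, by have := v.is_lt; omega⟩, rfl⟩
      have h1 : (lineGraph w s).Reachable a k.castSucc := ih k.castSucc (by simp only [Fin.val_castSucc]; omega) (by simp only [Fin.val_castSucc]; omega)
      have h2 : (lineGraph w s).Adj k.castSucc k.succ := h k (by omega) (by omega)
      rw [show v = k.succ from Fin.ext (by simp only [Fin.val_succ]; omega)]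
      exact h1.trans h2.reachable
  intro u v hu hub hv hvb
  exact (key ((u : ℕ) - a) u (by omega) hub).symm.trans (key ((v : ℕ) - a) v (by omega) hvb)

/-- **Steps-over ⇒ 1PI**: if every lepton line of `[v_i, v_j]` is stepped over by a photon of the subdiagram, the subdiagram is connected and stays
connected after eliminating any one lepton line (the two halves are rejoined by that photon). [cite: AoyamaEtAl2006, §6.1] -/
theorem isOnePIGraph_of_onePI (hij : i < j) (h : OnePI w i j) : IsOnePIGraph w i j := by
  have hij' := Fin.lt_def.1 hij
  refine ⟨segmentConnected_of_consecutive fun k hk hkj => lineGraph_adj_of_inl_mem (inl_mem_segment.2 ⟨hk, hkj⟩), fun k₀ hk₀ => ?_⟩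
  obtain ⟨hik₀, hk₀j⟩ := inl_mem_segment.1 hk₀
  obtain ⟨c, hc, a, b, hac, hbc, hak, hkb⟩ := h k₀ hk₀
  obtain ⟨-, hcin⟩ := inr_mem_segment.1 hc
  have ha := hcin a hac
  have hb := hcin b hbc
  set s := (segment w i j).erase (Sum.inl k₀) with hs
  -- leptons other than `k₀` survive
  have hlep : ∀ k : Fin m, (i : ℕ) ≤ k → (k : ℕ) + 1 ≤ j → (k : ℕ) ≠ k₀ → (lineGraph w s).Adj k.castSucc k.succ := fun k h1 h2 h3 =>
    lineGraph_adj_of_inl_mem (mem_erase.2 ⟨fun he => h3 (by cases he; rfl), inl_mem_segment.2 ⟨h1, h2⟩⟩)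
  -- the left half `[v_i, v_{k₀}]` and the right half `[v_{k₀+1}, v_j]` are each connected
  have hL : SegmentConnected w s i k₀.castSucc :=
    segmentConnected_of_consecutive fun k h1 h2 => hlep k h1 (by simp only [Fin.val_castSucc] at h2; omega)
      (by simp only [Fin.val_castSucc] at h2; omega)
  have hR : SegmentConnected w s k₀.succ j :=
    segmentConnected_of_consecutive fun k h1 h2 => hlep k (by simp only [Fin.val_succ] at h1; omega) h2
      (by simp only [Fin.val_succ] at h1; omega)
  -- the photon `c` joins `v_a` (left) to `v_b` (right)
  have hab : (lineGraph w s).Adj a b :=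
    ⟨fun he => by have := congrArg Fin.val he; omega, Sum.inr c, mem_erase.2 ⟨by simp, hc⟩, mem_ends_inr.2 hac, mem_ends_inr.2 hbc⟩
  -- every vertex of the segment is reachable from `v_a`
  have hreach : ∀ v : Fin (m + 1), (i : ℕ) ≤ v → (v : ℕ) ≤ j → (lineGraph w s).Reachable a v := by
    intro v hv1 hv2
    by_cases hvk : (v : ℕ) ≤ k₀
    · exact hL a v ha.1 (by simp only [Fin.val_castSucc]; omega) hv1 (by simp only [Fin.val_castSucc]; omega)
    · exact hab.reachable.trans (hR b v (by simp only [Fin.val_succ]; omega) hb.2 (by simp only [Fin.val_succ]; omega) hv2)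
  intro u v hu1 hu2 hv1 hv2
  exact (hreach u hu1 hu2).symm.trans (hreach v hv1 hv2)

/-- **1PI ⇒ steps-over**: if no photon of the subdiagram steps over the lepton line `(v_k, v_{k+1})`, every surviving line keeps both sides of the cut
`{v ≤ v_k} | {v ≥ v_{k+1}}`, so eliminating that lepton line disconnects `v_i` from `v_j`. [cite: AoyamaEtAl2006, §6.1 and §5.4] -/
theorem onePI_of_isOnePIGraph (hij : i < j) (h : IsOnePIGraph w i j) : OnePI w i j := by
  have hij' := Fin.lt_def.1 hij
  intro k hk
  obtain ⟨hik, hkj⟩ := inl_mem_segment.1 hk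
  by_contra hno
  have hcut : ∀ a b, (lineGraph w ((segment w i j).erase (Sum.inl k))).Adj a b → ((a : ℕ) ≤ k ↔ (b : ℕ) ≤ k) := by
    rintro a b ⟨hne, l, hl, hal, hbl⟩
    obtain ⟨hlk, hls⟩ := mem_erase.1 hl
    have hne' : (a : ℕ) ≠ b := fun he => hne (Fin.ext he)
    rcases l with k' | c
    · have hk' : (k' : ℕ) ≠ k := fun he => hlk (by rw [Fin.ext he])
      rcases mem_ends_inl.1 hal with ha | ha <;> rcases mem_ends_inl.1 hbl with hb | hb <;> omega
    · have hac := mem_ends_inr.1 hal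
      have hbc := mem_ends_inr.1 hbl
      by_cases hak : (a : ℕ) ≤ k
      · by_cases hbk : (b : ℕ) ≤ k
        · exact iff_of_true hak hbk
        · exact absurd ⟨c, hls, a, b, hac, hbc, hak, by omega⟩ hno
      · by_cases hbk : (b : ℕ) ≤ k
        · exact absurd ⟨c, hls, b, a, hbc, hac, hbk, by omega⟩ hno
        · exact iff_of_false hak hbk
  have := (iff_of_reachable hcut (h.2 k hk i j le_rfl (by omega) (by omega) le_rfl)).1 hik
  omega

/-- **«A q-type diagram is 1PI if and only if for each lepton line l_k, there exists at least one photon line that steps over the lepton line»** — for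
every segment `[v_i, v_j]`, `i < j`: the printed graph-theoretic condition and the printed steps-over criterion agree. [cite: AoyamaEtAl2006, §5.4 and §6.1] -/
theorem isOnePIGraph_iff_onePI (hij : i < j) : IsOnePIGraph w i j ↔ OnePI w i j :=
  ⟨onePI_of_isOnePIGraph hij, isOnePIGraph_of_onePI hij⟩

/-- Eliminating a PHOTON never disconnects a segment with `i < j` (the lepton path remains) — so «stays connected when any one of the lepton lines … is
eliminated» is the same as bridgelessness with respect to ALL lines. [cite: AoyamaEtAl2006, §5.4 («Since a q-type diagram is connected by lepton lines, it
is sufficient to check whether it stays connected when one of the lepton lines is eliminated»)] -/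
theorem segmentConnected_erase_inr (c : P) : SegmentConnected w ((segment w i j).erase (Sum.inr c)) i j :=
  segmentConnected_of_consecutive fun k hk hkj => lineGraph_adj_of_inl_mem (mem_erase.2 ⟨by simp, inl_mem_segment.2 ⟨hk, hkj⟩⟩)

end OnePIGraph

/-! ## The typed family IS the cell's table, word by word (STEP-0 ladder 6b, o8; the CORE-8 panel) -/

/-- `abccba` (6b (STEP-0 (ii) primary)): the UV-divergent subdiagrams are S234bc, S3c (the cell's gen-02 table, `S`/`V` + lepton line numbers + photon
letters; lepton line `l_k` = `Sum.inl (k−1)`, photon letters `a, b, …` = `Sum.inr 0, 1, …`). [cite: AoyamaEtAl2006, §6.1] -/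
theorem uvSubdiagrams_abccba :
    uvSubdiagrams (![0, 1, 2, 2, 1, 0] : Fin 6 → Fin 3) =
      {{Sum.inl 1, Sum.inl 2, Sum.inl 3, Sum.inr 1, Sum.inr 2},
       {Sum.inl 2, Sum.inr 2}} := by
  decide +kernel

/-- `abcddcba` (o8 rung word 1 (PLAN D17)): the UV-divergent subdiagrams are S23456bcd, S345cd, S4d (the cell's gen-02 table, `S`/`V` + lepton line numbers + photon
letters; lepton line `l_k` = `Sum.inl (k−1)`, photon letters `a, b, …` = `Sum.inr 0, 1, …`). [cite: AoyamaEtAl2006, §6.1] -/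
theorem uvSubdiagrams_abcddcba :
    uvSubdiagrams (![0, 1, 2, 3, 3, 2, 1, 0] : Fin 8 → Fin 4) =
      {{Sum.inl 1, Sum.inl 2, Sum.inl 3, Sum.inl 4, Sum.inl 5, Sum.inr 1, Sum.inr 2, Sum.inr 3},
       {Sum.inl 2, Sum.inl 3, Sum.inl 4, Sum.inr 2, Sum.inr 3},
       {Sum.inl 3, Sum.inr 3}} := by
  decide +kernel

/-- `abaccddb` (o8 rung word 2 (PLAN D17)): the UV-divergent subdiagrams are V12a, S4c, S6d, V234567bcd (the cell's gen-02 table, `S`/`V` + lepton line numbers + photon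
letters; lepton line `l_k` = `Sum.inl (k−1)`, photon letters `a, b, …` = `Sum.inr 0, 1, …`). [cite: AoyamaEtAl2006, §6.1] -/
theorem uvSubdiagrams_abaccddb :
    uvSubdiagrams (![0, 1, 0, 2, 2, 3, 3, 1] : Fin 8 → Fin 4) =
      {{Sum.inl 0, Sum.inl 1, Sum.inr 0},
       {Sum.inl 3, Sum.inr 2},
       {Sum.inl 5, Sum.inr 3},
       {Sum.inl 1, Sum.inl 2, Sum.inl 3, Sum.inl 4, Sum.inl 5, Sum.inl 6, Sum.inr 1, Sum.inr 2, Sum.inr 3}} := by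
  decide +kernel

/-- `abaccdedbe` (CORE-8 P01 = X086): the UV-divergent subdiagrams are V12a, S4c, V67d, V12345678abcd, V6789de, V23456789bcde (the cell's gen-02 table, `S`/`V` + lepton line numbers + photon
letters; lepton line `l_k` = `Sum.inl (k−1)`, photon letters `a, b, …` = `Sum.inr 0, 1, …`). [cite: AoyamaEtAl2006, §6.1] -/
theorem uvSubdiagrams_abaccdedbe :
    uvSubdiagrams (![0, 1, 0, 2, 2, 3, 4, 3, 1, 4] : Fin 10 → Fin 5) =
      {{Sum.inl 0, Sum.inl 1, Sum.inr 0},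
       {Sum.inl 3, Sum.inr 2},
       {Sum.inl 5, Sum.inl 6, Sum.inr 3},
       {Sum.inl 0, Sum.inl 1, Sum.inl 2, Sum.inl 3, Sum.inl 4, Sum.inl 5, Sum.inl 6, Sum.inl 7, Sum.inr 0, Sum.inr 1, Sum.inr 2, Sum.inr 3},
       {Sum.inl 5, Sum.inl 6, Sum.inl 7, Sum.inl 8, Sum.inr 3, Sum.inr 4},
       {Sum.inl 1, Sum.inl 2, Sum.inl 3, Sum.inl 4, Sum.inl 5, Sum.inl 6, Sum.inl 7, Sum.inl 8, Sum.inr 1, Sum.inr 2, Sum.inr 3, Sum.inr 4}} := by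
  decide +kernel

/-- `abcdcadeeb` (CORE-8 P04 = X312): the UV-divergent subdiagrams are V34c, V3456cd, V123456acd, S8e, V23456789bcde (the cell's gen-02 table, `S`/`V` + lepton line numbers + photon
letters; lepton line `l_k` = `Sum.inl (k−1)`, photon letters `a, b, …` = `Sum.inr 0, 1, …`). [cite: AoyamaEtAl2006, §6.1] -/
theorem uvSubdiagrams_abcdcadeeb :
    uvSubdiagrams (![0, 1, 2, 3, 2, 0, 3, 4, 4, 1] : Fin 10 → Fin 5) =
      {{Sum.inl 2, Sum.inl 3, Sum.inr 2},
       {Sum.inl 2, Sum.inl 3, Sum.inl 4, Sum.inl 5, Sum.inr 2, Sum.inr 3},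
       {Sum.inl 0, Sum.inl 1, Sum.inl 2, Sum.inl 3, Sum.inl 4, Sum.inl 5, Sum.inr 0, Sum.inr 2, Sum.inr 3},
       {Sum.inl 7, Sum.inr 4},
       {Sum.inl 1, Sum.inl 2, Sum.inl 3, Sum.inl 4, Sum.inl 5, Sum.inl 6, Sum.inl 7, Sum.inl 8, Sum.inr 1, Sum.inr 2, Sum.inr 3, Sum.inr 4}} := by
  decide +kernel

/-- `abcdeecadb` (CORE-8 P05 = X388): the UV-divergent subdiagrams are S5e, V3456ce, V345678cde, V12345678acde, V23456789bcde (the cell's gen-02 table, `S`/`V` + lepton line numbers + photon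
letters; lepton line `l_k` = `Sum.inl (k−1)`, photon letters `a, b, …` = `Sum.inr 0, 1, …`). [cite: AoyamaEtAl2006, §6.1] -/
theorem uvSubdiagrams_abcdeecadb :
    uvSubdiagrams (![0, 1, 2, 3, 4, 4, 2, 0, 3, 1] : Fin 10 → Fin 5) =
      {{Sum.inl 4, Sum.inr 4},
       {Sum.inl 2, Sum.inl 3, Sum.inl 4, Sum.inl 5, Sum.inr 2, Sum.inr 4},
       {Sum.inl 2, Sum.inl 3, Sum.inl 4, Sum.inl 5, Sum.inl 6, Sum.inl 7, Sum.inr 2, Sum.inr 3, Sum.inr 4},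
       {Sum.inl 0, Sum.inl 1, Sum.inl 2, Sum.inl 3, Sum.inl 4, Sum.inl 5, Sum.inl 6, Sum.inl 7, Sum.inr 0, Sum.inr 2, Sum.inr 3, Sum.inr 4},
       {Sum.inl 1, Sum.inl 2, Sum.inl 3, Sum.inl 4, Sum.inl 5, Sum.inl 6, Sum.inl 7, Sum.inl 8, Sum.inr 1, Sum.inr 2, Sum.inr 3, Sum.inr 4}} := by
  decide +kernel

/-- `abacdcedeb` (CORE-8 P07 = X104): the UV-divergent subdiagrams are V12a, V45c, V4567cd, V78e, V5678de, S45678cde, V23456789bcde (the cell's gen-02 table, `S`/`V` + lepton line numbers + photon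
letters; lepton line `l_k` = `Sum.inl (k−1)`, photon letters `a, b, …` = `Sum.inr 0, 1, …`). [cite: AoyamaEtAl2006, §6.1] -/
theorem uvSubdiagrams_abacdcedeb :
    uvSubdiagrams (![0, 1, 0, 2, 3, 2, 4, 3, 4, 1] : Fin 10 → Fin 5) =
      {{Sum.inl 0, Sum.inl 1, Sum.inr 0},
       {Sum.inl 3, Sum.inl 4, Sum.inr 2},
       {Sum.inl 3, Sum.inl 4, Sum.inl 5, Sum.inl 6, Sum.inr 2, Sum.inr 3},
       {Sum.inl 6, Sum.inl 7, Sum.inr 4},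
       {Sum.inl 4, Sum.inl 5, Sum.inl 6, Sum.inl 7, Sum.inr 3, Sum.inr 4},
       {Sum.inl 3, Sum.inl 4, Sum.inl 5, Sum.inl 6, Sum.inl 7, Sum.inr 2, Sum.inr 3, Sum.inr 4},
       {Sum.inl 1, Sum.inl 2, Sum.inl 3, Sum.inl 4, Sum.inl 5, Sum.inl 6, Sum.inl 7, Sum.inl 8, Sum.inr 1, Sum.inr 2, Sum.inr 3, Sum.inr 4}} := by
  decide +kernel

/-- `abcdedeacb` (CORE-8 P09 = X382): the UV-divergent subdiagrams are V45d, V56e, S456de, V345678cde, V12345678acde, V23456789bcde (the cell's gen-02 table, `S`/`V` + lepton line numbers + photon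
letters; lepton line `l_k` = `Sum.inl (k−1)`, photon letters `a, b, …` = `Sum.inr 0, 1, …`). [cite: AoyamaEtAl2006, §6.1] -/
theorem uvSubdiagrams_abcdedeacb :
    uvSubdiagrams (![0, 1, 2, 3, 4, 3, 4, 0, 2, 1] : Fin 10 → Fin 5) =
      {{Sum.inl 3, Sum.inl 4, Sum.inr 3},
       {Sum.inl 4, Sum.inl 5, Sum.inr 4},
       {Sum.inl 3, Sum.inl 4, Sum.inl 5, Sum.inr 3, Sum.inr 4},
       {Sum.inl 2, Sum.inl 3, Sum.inl 4, Sum.inl 5, Sum.inl 6, Sum.inl 7, Sum.inr 2, Sum.inr 3, Sum.inr 4},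
       {Sum.inl 0, Sum.inl 1, Sum.inl 2, Sum.inl 3, Sum.inl 4, Sum.inl 5, Sum.inl 6, Sum.inl 7, Sum.inr 0, Sum.inr 2, Sum.inr 3, Sum.inr 4},
       {Sum.inl 1, Sum.inl 2, Sum.inl 3, Sum.inl 4, Sum.inl 5, Sum.inl 6, Sum.inl 7, Sum.inl 8, Sum.inr 1, Sum.inr 2, Sum.inr 3, Sum.inr 4}} := by
  decide +kernel

/-- `abcbdceeda` (CORE-8 P11 = X228): the UV-divergent subdiagrams are V23b, V2345bc, S7e, V5678de, V345678cde, S2345678bcde (the cell's gen-02 table, `S`/`V` + lepton line numbers + photon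
letters; lepton line `l_k` = `Sum.inl (k−1)`, photon letters `a, b, …` = `Sum.inr 0, 1, …`). [cite: AoyamaEtAl2006, §6.1] -/
theorem uvSubdiagrams_abcbdceeda :
    uvSubdiagrams (![0, 1, 2, 1, 3, 2, 4, 4, 3, 0] : Fin 10 → Fin 5) =
      {{Sum.inl 1, Sum.inl 2, Sum.inr 1},
       {Sum.inl 1, Sum.inl 2, Sum.inl 3, Sum.inl 4, Sum.inr 1, Sum.inr 2},
       {Sum.inl 6, Sum.inr 4},
       {Sum.inl 4, Sum.inl 5, Sum.inl 6, Sum.inl 7, Sum.inr 3, Sum.inr 4},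
       {Sum.inl 2, Sum.inl 3, Sum.inl 4, Sum.inl 5, Sum.inl 6, Sum.inl 7, Sum.inr 2, Sum.inr 3, Sum.inr 4},
       {Sum.inl 1, Sum.inl 2, Sum.inl 3, Sum.inl 4, Sum.inl 5, Sum.inl 6, Sum.inl 7, Sum.inr 1, Sum.inr 2, Sum.inr 3, Sum.inr 4}} := by
  decide +kernel

/-- `abcabddeec` (CORE-8 P13 = X164): the UV-divergent subdiagrams are V1234ab, S6d, S8e, V23456789bcde (the cell's gen-02 table, `S`/`V` + lepton line numbers + photon
letters; lepton line `l_k` = `Sum.inl (k−1)`, photon letters `a, b, …` = `Sum.inr 0, 1, …`). [cite: AoyamaEtAl2006, §6.1] -/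
theorem uvSubdiagrams_abcabddeec :
    uvSubdiagrams (![0, 1, 2, 0, 1, 3, 3, 4, 4, 2] : Fin 10 → Fin 5) =
      {{Sum.inl 0, Sum.inl 1, Sum.inl 2, Sum.inl 3, Sum.inr 0, Sum.inr 1},
       {Sum.inl 5, Sum.inr 3},
       {Sum.inl 7, Sum.inr 4},
       {Sum.inl 1, Sum.inl 2, Sum.inl 3, Sum.inl 4, Sum.inl 5, Sum.inl 6, Sum.inl 7, Sum.inl 8, Sum.inr 1, Sum.inr 2, Sum.inr 3, Sum.inr 4}} := by
  decide +kernel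

/-- `abcdedecba` (CORE-8 P14 = X062): the UV-divergent subdiagrams are V45d, V56e, S456de, S34567cde, S2345678bcde (the cell's gen-02 table, `S`/`V` + lepton line numbers + photon
letters; lepton line `l_k` = `Sum.inl (k−1)`, photon letters `a, b, …` = `Sum.inr 0, 1, …`). [cite: AoyamaEtAl2006, §6.1] -/
theorem uvSubdiagrams_abcdedecba :
    uvSubdiagrams (![0, 1, 2, 3, 4, 3, 4, 2, 1, 0] : Fin 10 → Fin 5) =
      {{Sum.inl 3, Sum.inl 4, Sum.inr 3},
       {Sum.inl 4, Sum.inl 5, Sum.inr 4},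
       {Sum.inl 3, Sum.inl 4, Sum.inl 5, Sum.inr 3, Sum.inr 4},
       {Sum.inl 2, Sum.inl 3, Sum.inl 4, Sum.inl 5, Sum.inl 6, Sum.inr 2, Sum.inr 3, Sum.inr 4},
       {Sum.inl 1, Sum.inl 2, Sum.inl 3, Sum.inl 4, Sum.inl 5, Sum.inl 6, Sum.inl 7, Sum.inr 1, Sum.inr 2, Sum.inr 3, Sum.inr 4}} := by
  decide +kernel

end Literature.MathematicalPhysics.QuantumFieldTheory.AoyamaEtAl2006
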